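import Literature.AlgebraicGeometry.Resolution.WeightedCentreZKernelFlow
import HarnessLib

/-!
# Weighted centres — THEOREM A⁺, step (i): an isotropy moves a bottom slot at most by a pure term

Instrument for engine 1's `W(f)` TOY MODEL (cell `pub-rosobs`, LF-MODEL-eng1-g45 §6.2 THEOREM A⁺, first paragraph of the proof: "Let `r := w(L₁)`. The data of `X` on a
slot of `L₁` are constants of weight `r − m` (nothing is lighter), so `X` moves `L₁` at most by a pure term: `X(ε_z) = ε_z + σ^r c(z)`, and only if `r ∈ ℕ`"), NOT a
resolution theorem and NOT about the invariant of [AbramovichTemkinWlodarczyk2024].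

* `eq_C_coeff_zero_of_lt` / `eq_zero_of_lt_of_ne_zero` — a weighted-homogeneous polynomial of weight `m` below every variable weight is a constant, and vanishes if
  `m ≠ 0` (non-negative weights; bookkeeping with `Finsupp.le_weight_of_ne_zero`);
* `exists_apply_CX_bottom` — for a graded `k[σ]`-automorphism `x ≡ id (mod σ)` and a slot `z` of MINIMAL weight `w z = r ∈ ℕ_{>0}`: `x(ε_z) = ε_z + c σ^r` with `c ∈ k`.

References: [Lang2002, Ch. IV §1]; [AbramovichTemkinWlodarczyk2024, §5.1 (p. 1575), Thm. 5.3.1 (2)–(3) (p. 1578)].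
-/

namespace Literature.AlgebraicGeometry.Resolution.WeightedBlowup.BottomClimb

open Polynomial OrderFiltration LevelProjection

variable {k : Type*} [CommRing k] {ι : Type*} {w : ι → ℚ}

/-- A weighted-homogeneous polynomial whose weight lies below every variable weight is a constant (non-negative weights; bookkeeping).
[cite: AbramovichTemkinWlodarczyk2024, §5.1 (p. 1575)] -/
theorem eq_C_coeff_zero_of_lt (hw : ∀ i, 0 ≤ w i) {P : MvPolynomial ι k} {m μ : ℚ} (hP : MvPolynomial.IsWeightedHomogeneous w P m)
    (hμ : ∀ j, μ ≤ w j) (hm : m < μ) : P = MvPolynomial.C (P.coeff 0) := by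
  classical
  refine MvPolynomial.ext _ _ fun d => ?_
  rw [MvPolynomial.coeff_C]
  split_ifs with hd
  · rw [hd]
  · by_contra hne
    obtain ⟨j, hj⟩ : ∃ j, d j ≠ 0 := by
      by_contra hall
      push Not at hall
      exact (Ne.symm hd) (Finsupp.ext fun j => by rw [hall j, Finsupp.coe_zero, Pi.zero_apply])
    have hle : w j ≤ Finsupp.weight w d := Finsupp.le_weight_of_ne_zero hw hj
    rw [hP hne] at hle
    exact absurd (lt_of_lt_of_le hm (hμ j)) (not_lt.mpr hle)

/-- … and it vanishes when its weight is non-zero (bookkeeping). [cite: AbramovichTemkinWlodarczyk2024, §5.1 (p. 1575)] -/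
theorem eq_zero_of_lt_of_ne_zero (hw : ∀ i, 0 ≤ w i) {P : MvPolynomial ι k} {m μ : ℚ} (hP : MvPolynomial.IsWeightedHomogeneous w P m)
    (hμ : ∀ j, μ ≤ w j) (hm : m < μ) (hm0 : m ≠ 0) : P = 0 := by
  rw [eq_C_coeff_zero_of_lt hw hP hμ hm]
  by_cases h0 : P.coeff 0 = 0
  · rw [h0, map_zero]
  · have h := hP h0
    rw [map_zero] at h
    exact absurd h.symm hm0

/-- **An isotropy moves a bottom slot at most by a pure term** (LF-MODEL-eng1-g45 §6.2, THEOREM A⁺, first step): for a graded `k[σ]`-automorphism `x` of `k[ε][σ]` with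
`x ≡ id (mod σ)` (`wt σ = 1`, non-negative slot weights) and a slot `z` of MINIMAL weight `w z = r`, `r ≥ 1` an integer, `x(ε_z) = ε_z + c·σ^r` with `c ∈ k` — the
`σ^s`-coefficient of `x(ε_z)` weighs `r − s < r ≤` every variable, so it is a constant, non-zero only for `s = r` (bookkeeping on total weights).  Instrument for engine 1's
`W(f)` toy model, NOT a resolution theorem. [cite: Lang2002, Ch. IV §1; AbramovichTemkinWlodarczyk2024, §5.1 (p. 1575), Thm. 5.3.1 (2)–(3) (p. 1578)] -/
theorem exists_apply_CX_bottom (hw : ∀ i, 0 ≤ w i) {x : (MvPolynomial ι k)[X] ≃+* (MvPolynomial ι k)[X]} (hxg : x ∈ graded w (1 : ℚ))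
    (hx1 : x ∈ level (X : (MvPolynomial ι k)[X]) 1) {z : ι} (hmin : ∀ j, w z ≤ w j) {r : ℕ} (hwz : w z = r) (hr : 0 < r) :
    ∃ c : k, x (C (MvPolynomial.X z)) = C (MvPolynomial.X z) + C (MvPolynomial.C c) * X ^ r := by
  have hTW : IsTW w (1 : ℚ) (w z) (x (C (MvPolynomial.X z))) := hxg.1.isTW_CX z
  have hwt : ∀ s : ℕ, MvPolynomial.IsWeightedHomogeneous w ((x (C (MvPolynomial.X z))).coeff s) ((r : ℚ) - s) := fun s => by
    have h := hTW s
    rwa [nsmul_eq_mul, mul_one, hwz] at h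
  have hμ : ∀ j, (r : ℚ) ≤ w j := fun j => hwz ▸ hmin j
  obtain ⟨t, ht⟩ := hx1.2 (C (MvPolynomial.X z))
  refine ⟨((x (C (MvPolynomial.X z))).coeff r).coeff 0, Polynomial.ext fun s => ?_⟩
  rw [coeff_add, coeff_C, Polynomial.coeff_C_mul_X_pow]
  by_cases hs0 : s = 0
  · subst hs0
    rw [if_pos rfl, if_neg (Nat.pos_iff_ne_zero.mp hr).symm, add_zero, ht, coeff_add, coeff_C_zero, pow_one, mul_coeff_zero, coeff_X_zero,
      zero_mul, add_zero]
  · rw [if_neg hs0, zero_add]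
    by_cases hsr : s = r
    · subst hsr
      rw [if_pos rfl]
      have h0s : (0 : ℚ) < s := by exact_mod_cast hr
      exact eq_C_coeff_zero_of_lt hw (hwt s) hμ (by linarith)
    · rw [if_neg hsr]
      refine eq_zero_of_lt_of_ne_zero hw (hwt s) hμ ?_ ?_
      · have : (0 : ℚ) < s := by exact_mod_cast Nat.pos_of_ne_zero hs0
        linarith
      · have : (s : ℚ) ≠ r := by exact_mod_cast hsr
        intro h
        exact this (by linarith)

end Literature.AlgebraicGeometry.Resolution.WeightedBlowup.BottomClimb
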